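import Summits.QuantumFields.BalabanUV.T4Continuum.Support.ShellMeasureLandauCorrectionB7
import Literature.MathematicalPhysics.QuantumFieldTheory.Balaban1983to89.B9Eq315QTower
import Literature.MathematicalPhysics.QuantumFieldTheory.Balaban1983to89.B7Eq123General
import HarnessLib

/-!
# T⁴ programme, node NE3 — census R26′, step 2a: THE TELESCOPING IDENTITY OF BAŁABAN's k-FOLD REMAINDER — the difference between the composed linear
# parts and the nonlinear composite is (minus) the sum of the one-step remainders `C(Ū₀ⁱ, A_i, ·)` propagated LINEARLY from level `i+1` to level `k`

Cell `pub-balaban-gaps` (YM blitz, track G2, seat `ne3`, unit `pub-balaban-gaps-ne3`; writer prover-pub-balaban-gaps-ne3-g4-0, 2026-08-23), census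
`run/shared/lean/pub/pub-balaban-gaps/ne/NE3.md` §4 R26′ ∕ §10 F8.  WHY.  Finding F8: the Π-REG majorant (the `sfClass` END's last non-printed input) is removable at
`d = 4` by the ℓ² TOWER of one-step remainders.  Its algebraic skeleton is the telescoping of `T i := Lin_{k←i}(A_i)`, `A_i = Q_i(U₀)B` the nonlinear composite
(`logCovIter`), `Lin_{k←i}` the composed linear parts from level `i` (`linCovIter` at the background `Ū₀ⁱ`): `T 0 = L^kηQ_k(U₀)B` (linear), `T k = Q_k(U₀, B)` (nonlinear), and
`T i − T (i+1) = −Lin_{k←i+1}(C_i)` with `C_i(z, κ) = C(Ū₀ⁱ, A_i, ⟨L•z, κ⟩)` the ONE-STEP remainder (122) — by the level-composition law of the linear parts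
(`B9Eq315QTower.linCovIter_add`), `Q = L(Q·) + C` (`B7Prop3GeneralLinear.Qcov_eq_linQcov_add_Ccov`), and ADDITIVITY of the composed linear parts in the field at every level background
(`ShellMeasureLandauCorrectionB7.linCovIter_add`, which needs the [B7]-Prop-4 regime at the level background: `pdev Ū₀^{i+1} < 2α₀(L^{k−i−1})⁻²` by `level_data`, whence the lines
`C0·(2α₀) ≤ 1∕3`, `4·(2α₀) ≤ c2′`).  Step 1 (`RemainderSumsStepB8`, gen 4) bounds each `C_i` in ℓ¹∕ℓ² by the field's ℓ²-mass; steps 2b–4 (ℓ² propagation, the strong induction, the supplier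
re-wired) are NOT here.

CONTENT (all [folklore]; 0 sorry; 0 def): `linCovIter_one`, `logCovIter_succ_eq_lin_add_Ccov`, **`telescope_step`** (`T i − T (i+1) = −Lin_{k←i+1} C_i`), `telescope_zero`∕`telescope_top`
(the endpoints), for a background `U₀` in an averaging-closed subgroup with `pdev U₀ < α₀(L^k)⁻²` in the regime `0 < α₀`, `C0·(2α₀) ≤ 1∕3`, `8α₀ ≤ c2′`.

HONEST FRAMING.  Algebra of [Balaban1985Averaging] (122)∕(127) on OUR objects; NOTHING of Bałaban's is proved beyond it; **NE3 is NOT proved**; spine PROVED 0∕9; finite T⁴ rung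
(B)+1 — NOT continuum YM on ℝ⁴, NOT infinite volume, NOT mass gap, NOT `BetaPertH`, NOT Clay.  PLACEMENT: `Summits/QuantumFields/BalabanUV/T4Continuum/Spine/NE3/`.
-/

noncomputable section

open scoped BigOperators
open NormedSpace Finset Metric

namespace Summit.QuantumFields.BalabanUV.T4Continuum.NE3.RemainderTelescopeB8

open Literature.MathematicalPhysics.QuantumFieldTheory.Balaban1983to89
open B7Prop1Explicit B7Prop2Explicit B7Prop3Flat B7Prop3GeneralLinear
open B7Prop4GeneralLevels (logCovIter linCovIter logCovIter_succ linCovIter_succ logCovIter_zero linCovIter_zero level_regularity)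
open B7Eq123General (level_data)
open B9Eq315QTower (avgIter_add)
open ShellMeasureLandauCorrectionB7 (linCovIter_add linCovIter_smul)

variable {d : ℕ} {𝔸 : Type*} [NormedRing 𝔸] [NormedAlgebra ℂ 𝔸] [CompleteSpace 𝔸] [NormOneClass 𝔸]

/-! ## §1 One linear step from a level background; the nonlinear step split as linear part plus remainder -/

omit [NormOneClass 𝔸] in
/-- One composed linear step is the one-step linear part (122) read on the coarse lattice: `linCovIter L V Y 1 z κ = L(Q(V)Y)_{⟨L•z, κ⟩}`. [folklore] -/
theorem linCovIter_one (L : ℕ) (V : Site d → Fin d → 𝔸ˣ) (Y : Site d → Fin d → 𝔸) (z : Site d) (κ : Fin d) :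
    linCovIter L V Y 1 z κ = linQcov L V Y ((L : ℤ) • z) κ := by
  rw [linCovIter_succ, linCovIter_zero, avgIter_zero]

omit [NormOneClass 𝔸] in
/-- The nonlinear step splits: `A_{i+1}(z, κ) = L(Q(Ū₀ⁱ)A_i)_{⟨L•z,κ⟩} + C(Ū₀ⁱ, A_i, ⟨L•z,κ⟩)` ((122) at the level background). [folklore] -/
theorem logCovIter_succ_eq_lin_add_Ccov (L : ℕ) (U₀ : Site d → Fin d → 𝔸ˣ) (B : Site d → Fin d → 𝔸) (i : ℕ) :
    logCovIter L U₀ B (i + 1)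
      = (fun z κ => linQcov L (avgIter L U₀ i) (logCovIter L U₀ B i) ((L : ℤ) • z) κ)
        + fun z κ => Ccov L (avgIter L U₀ i) (logCovIter L U₀ B i) ((L : ℤ) • z) κ := by
  funext z κ
  rw [Pi.add_apply, Pi.add_apply, logCovIter_succ, Qcov_eq_linQcov_add_Ccov]

/-! ## §2 The telescoping step and the endpoints -/

section Regime

variable (L : ℕ) (hL : 2 ≤ L) {G : Subgroup 𝔸ˣ} (hG : AvgClosed d L G) (k : ℕ)
  (U₀ : Site d → Fin d → 𝔸ˣ) (hU₀ : ∀ x κ, U₀ x κ ∈ G) {α₀ : ℝ} (hα : 0 < α₀)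
  (hα3 : C0 d * (2 * α₀) ≤ 1 / 3) (hα4 : 4 * (2 * α₀) ≤ c2' d L) (h52 : pdev U₀ < α₀ * (((L : ℝ) ^ k)⁻¹) ^ 2)

include hL hG hU₀ hα hα3 hα4 h52 in
/-- **THE TELESCOPING STEP**: for `i < k`, with `A_i = Q_i(U₀)B` (`logCovIter`) and `Lin` the composed linear parts at the level backgrounds,
`Lin_{k−i}(Ū₀ⁱ)(A_i) − Lin_{k−i−1}(Ū₀^{i+1})(A_{i+1}) = −Lin_{k−i−1}(Ū₀^{i+1})(C_i)`, `C_i(z,κ) = C(Ū₀ⁱ, A_i, ⟨L•z,κ⟩)` — the level-composition law of the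
linear parts, (122), and additivity of the composed linear parts at the background `Ū₀^{i+1}` (its regime from `level_data`: `pdev Ū₀^{i+1} < 2α₀·(L^{k−i−1})⁻²`).
[folklore] -/
theorem telescope_step {i : ℕ} (hi : i + 1 ≤ k) (B : Site d → Fin d → 𝔸) :
    linCovIter L (avgIter L U₀ i) (logCovIter L U₀ B i) (k - i)
        - linCovIter L (avgIter L U₀ (i + 1)) (logCovIter L U₀ B (i + 1)) (k - (i + 1))
      = -linCovIter L (avgIter L U₀ (i + 1))
          (fun z κ => Ccov L (avgIter L U₀ i) (logCovIter L U₀ B i) ((L : ℤ) • z) κ) (k - (i + 1)) := by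
  set m : ℕ := k - (i + 1) with hm
  have hkm : k - i = 1 + m := by omega
  -- the first term: one linear step at `Ū₀ⁱ`, then `m` steps from `Ū₀^{i+1}`
  have h1 : linCovIter L (avgIter L U₀ i) (logCovIter L U₀ B i) (k - i)
      = linCovIter L (avgIter L U₀ (i + 1))
          (fun z κ => linQcov L (avgIter L U₀ i) (logCovIter L U₀ B i) ((L : ℤ) • z) κ) m := by
    have e1 : linCovIter L (avgIter L U₀ i) (logCovIter L U₀ B i) 1
        = fun z κ => linQcov L (avgIter L U₀ i) (logCovIter L U₀ B i) ((L : ℤ) • z) κ :=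
      funext fun z => funext fun κ => linCovIter_one L _ _ z κ
    rw [hkm, B9Eq315QTower.linCovIter_add L (avgIter L U₀ i) (logCovIter L U₀ B i) 1 m, ← avgIter_add L U₀ i 1, e1]
  -- the regime at the background `Ū₀^{i+1}` with `k′ = m` levels to go
  have hα2 : 0 < 2 * α₀ := by linarith
  have hα3' : C0 d * α₀ ≤ 1 / 3 := by
    have hC : 0 ≤ C0 d := by unfold C0; positivity
    nlinarith
  have hα4' : 4 * α₀ ≤ c2' d L := by linarith
  obtain ⟨-, -, hpd, -⟩ := level_data L hL hG k U₀ hU₀ hα hα3' hα4' h52 (i + 1) hi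
  have hmem : ∀ x κ, avgIter L U₀ (i + 1) x κ ∈ G :=
    (level_regularity L hL hG k U₀ hU₀ hα hα3' (by linarith) h52 (i + 1) hi).2
  have h52' : pdev (avgIter L U₀ (i + 1)) < 2 * α₀ * (((L : ℝ) ^ m)⁻¹) ^ 2 := by
    have hL0 : (0 : ℝ) < L := by exact_mod_cast (show 0 < L by omega)
    have e : (L : ℝ) ^ (i + 1) * ((L : ℝ) ^ k)⁻¹ = ((L : ℝ) ^ m)⁻¹ := by
      have hk : k = (i + 1) + m := by omega
      have hne : (L : ℝ) ^ (i + 1) ≠ 0 := pow_ne_zero _ hL0.ne'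
      rw [hk, pow_add ((L : ℝ)) (i + 1) m, mul_inv, ← mul_assoc, mul_inv_cancel₀ hne, one_mul]
    rw [e] at hpd
    linarith [hpd]
  -- additivity at `Ū₀^{i+1}`
  have hadd := linCovIter_add L hL hG m (avgIter L U₀ (i + 1)) hmem hα2 hα3 hα4 h52'
    (fun z κ => linQcov L (avgIter L U₀ i) (logCovIter L U₀ B i) ((L : ℤ) • z) κ)
    (fun z κ => Ccov L (avgIter L U₀ i) (logCovIter L U₀ B i) ((L : ℤ) • z) κ) m le_rfl
  rw [h1, logCovIter_succ_eq_lin_add_Ccov, hadd]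
  abel

omit hL hG hU₀ hα hα3 hα4 h52 [NormOneClass 𝔸] in
/-- The top endpoint: `Lin_k(U₀)(A_0) = L^kηQ_k(U₀)B` (the composed linear parts of `B` itself). [folklore] -/
theorem telescope_zero (B : Site d → Fin d → 𝔸) :
    linCovIter L (avgIter L U₀ 0) (logCovIter L U₀ B 0) (k - 0) = linCovIter L U₀ B k := by
  rw [avgIter_zero, logCovIter_zero, Nat.sub_zero]

omit hL hG hU₀ hα hα3 hα4 h52 [NormOneClass 𝔸] in
/-- The bottom endpoint: `Lin_0(Ū₀ᵏ)(A_k) = Q_k(U₀, B)` (the nonlinear composite). [folklore] -/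
theorem telescope_top (B : Site d → Fin d → 𝔸) :
    linCovIter L (avgIter L U₀ k) (logCovIter L U₀ B k) (k - k) = logCovIter L U₀ B k := by
  rw [Nat.sub_self, linCovIter_zero]

include hL hG hU₀ hα hα3 hα4 h52 in
/-- **THE TELESCOPED IDENTITY** (summed form, counted from the top): for every `t ≤ k`, with `i = k − t`,
`Lin_{t}(Ū₀ⁱ)(A_i) − Q_k(U₀, B) = −Σ_{i ≤ i′ < k} Lin_{k−i′−1}(Ū₀^{i′+1})(C_{i′})`. [folklore] -/
theorem telescope_sum (B : Site d → Fin d → 𝔸) :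
    ∀ t ≤ k, linCovIter L (avgIter L U₀ (k - t)) (logCovIter L U₀ B (k - t)) (k - (k - t)) - logCovIter L U₀ B k
      = -∑ i' ∈ Finset.Ico (k - t) k, linCovIter L (avgIter L U₀ (i' + 1))
          (fun z κ => Ccov L (avgIter L U₀ i') (logCovIter L U₀ B i') ((L : ℤ) • z) κ) (k - (i' + 1)) := by
  intro t
  induction t with
  | zero =>
      intro _
      rw [Nat.sub_zero, telescope_top, sub_self, Finset.Ico_self, Finset.sum_empty, neg_zero]
  | succ t ih =>
      intro ht
      have hi' : k - (t + 1) + 1 ≤ k := by omega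
      have hstep := telescope_step L hL hG k U₀ hU₀ hα hα3 hα4 h52 hi' B
      have hrest := ih (by omega)
      have e1 : k - (t + 1) + 1 = k - t := by omega
      rw [e1] at hstep
      rw [Finset.sum_eq_sum_Ico_succ_bot (by omega : k - (t + 1) < k), e1, neg_add]
      calc linCovIter L (avgIter L U₀ (k - (t + 1))) (logCovIter L U₀ B (k - (t + 1))) (k - (k - (t + 1))) - logCovIter L U₀ B k
          = (linCovIter L (avgIter L U₀ (k - (t + 1))) (logCovIter L U₀ B (k - (t + 1))) (k - (k - (t + 1)))
              - linCovIter L (avgIter L U₀ (k - t)) (logCovIter L U₀ B (k - t)) (k - (k - t)))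
            + (linCovIter L (avgIter L U₀ (k - t)) (logCovIter L U₀ B (k - t)) (k - (k - t)) - logCovIter L U₀ B k) := by abel
        _ = _ := by rw [hstep, hrest]

include hL hG hU₀ hα hα3 hα4 h52 in
/-- **[B7] PROP. 4's k-FOLD REMAINDER AS THE SUM OF PROPAGATED ONE-STEP REMAINDERS**:
`L^kηQ_k(U₀)B − Q_k(U₀, B) = −Σ_{i<k} Lin_{k−i−1}(Ū₀^{i+1})(C_i)`, `C_i(z,κ) = C(Ū₀ⁱ, Q_i(U₀)B, ⟨L•z,κ⟩)`. [folklore] -/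
theorem linCovIter_sub_logCovIter_eq_sum (B : Site d → Fin d → 𝔸) :
    linCovIter L U₀ B k - logCovIter L U₀ B k
      = -∑ i ∈ Finset.range k, linCovIter L (avgIter L U₀ (i + 1))
          (fun z κ => Ccov L (avgIter L U₀ i) (logCovIter L U₀ B i) ((L : ℤ) • z) κ) (k - (i + 1)) := by
  have h := telescope_sum L hL hG k U₀ hU₀ hα hα3 hα4 h52 B k le_rfl
  rw [Nat.sub_self, telescope_zero, Finset.range_eq_Ico] at *
  exact h

end Regime

end Summit.QuantumFields.BalabanUV.T4Continuum.NE3.RemainderTelescopeB8
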